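import Literature.NumberTheory.LFunctions.SuzukiPhiFunctions
import HarnessLib

/-!
# Suzuki's structure functions `A(t,z)`, `B(t,z)`, `E(t,z) = A(t,z) − iB(t,z)` and the Hamiltonian
# `H(t) = diag(1/γ(t), γ(t))` built from the solutions `φ^{±}(t,x)` of the integral equations

M. Suzuki, *Hamiltonians arising from L-functions in the Selberg class*, J. Funct. Anal. **281** (2021)
109116 = arXiv:1606.05726 [Suzuki2021Hamiltonians], §3.5–§3.6 (and Lemma 4.1 / Thm. 2.2 for the `ζ`
specialisation), AS PRINTED. Continuation of `SuzukiPhiFunctions.lean` (the extended solutions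
`φ^ε(t,x) = suzukiPhiExt K ε t x` of (3.4)/(3.7)); requested by the RH criterion column DBR (cell
`run/shared/lean/pub/rh-dbr`, seat rh-dbr-eng-5 «structure functions `E` from the kernel»).

> (3.23) `μ(t) = φ⁺(t,t) + φ⁻(t,t)`; (3.26)
> `𝔉(t,x) := ½(ϱ(x−t) + ∫_t^∞ ϱ(x−y)φ⁺(t,y) dy)`, `𝔊(t,x) := ½(ϱ(x−t) − ∫_t^∞ ϱ(x−y)φ⁻(t,y) dy)`;
> (3.27) `𝔄(t,z) := ∫ 𝔉(t,x)e^{izx} dx`, `−i𝔅(t,z) := ∫ 𝔊(t,x)e^{izx} dx`;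
> (3.32) `m(t) := exp(∫₀ᵗ μ(s) ds)`; (3.33) `H(t) := diag(1/γ(t), γ(t))`, `γ(t) = m(t)²`;
> (3.36) `F(t,x) = m(t)·𝔉(t,x)`, `G(t,x) = m(t)⁻¹·𝔊(t,x)`; (3.38) `A(t,z) = m(t)𝔄(t,z)`,
> `B(t,z) = m(t)⁻¹𝔅(t,z)`; (3.39) `E(t,z) = A(t,z) − iB(t,z)`; and
> `Φ^ε(t,z) = ∫ φ^ε(t,x) e^{izx} dx` (after Cor. 3.1).
> Here `ϱ` is the function of (K1) (`E = 𝖥ϱ`, `(𝖥f)(z) = ∫ f(x)e^{ixz} dx`, §3.1) and `K` the kernel of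
> (K2)–(K3) (`Θ_E = E♯/E = 𝖥K` on `Im z > c`, `K = 0` on `(−∞,0)`).
> **Theorem 3.1.** … `A(t,z)`, `B(t,z)` are real entire functions of `z` …, even/odd …,
> `ᵗ(A(t,z),B(t,z))` solves the canonical system (2.11) on `[0,τ)` associated with `H`, and
> `E(z) = A(0,z) − iB(0,z)`.
> **Lemma 4.1 / (4.1).** `ϱ_L^{ω,ν}(x) = (1/2π)∫_{Im z = c} E_L^{ω,ν}(z)e^{−izx} dz` (any `c`; real-valued,
> `|ϱ| ≪_n e^{−n|x|}`, `E_L^{ω,ν} = 𝖥ϱ_L^{ω,ν}`). **Thm. 2.2 / (2.12)** `E_L^{ω,ν}(t,z) = A_L^{ω,ν}(t,z) − iB_L^{ω,ν}(t,z)`.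

## What this file provides (DEFINITIONS with bodies + unfolding API; no named facts)

All objects are defined for an ARBITRARY pair of real functions `(ϱ, K)` (Suzuki's data (K1)–(K3)) and
every real `t`, with the tree's `suzukiPhiExt` as `φ^ε(t,·)`; namespace `SuzukiStructure`:

* `SuzukiStructure.fourier f z = ∫ f(x)e^{izx} dx` — Suzuki's `𝖥` (§3.1) on real functions;
* `SuzukiStructure.mu K t` (3.23), `SuzukiStructure.m K t` (3.32), `SuzukiStructure.gamma K t`,
  `SuzukiStructure.hamiltonian K t` (3.33);
* `SuzukiStructure.frakFG ϱ K ε t x = ½(ϱ(x−t) + ε∫_{(t,∞)} ϱ(x−y)φ^ε(t,y) dy)` — the common shape of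
  (3.26): `frakF = frakFG … 1` is `𝔉`, `frakG = frakFG … (−1)` is `𝔊`;
* `SuzukiStructure.frakA`, `SuzukiStructure.frakB` (3.27); `SuzukiStructure.bigF`, `SuzukiStructure.bigG`
  (3.36); `SuzukiStructure.structA`, `SuzukiStructure.structB` (3.38); `SuzukiStructure.structE` (3.39);
  `SuzukiStructure.phiTransform K ε t z = Φ^ε(t,z)`;
* the hypothesis bundle `SuzukiStructure.IsSuzukiPair ϱ K` = (K1)–(K3) in the form the theorems consume
  (see «Design choices»);
* the `ζ` specialisation: `suzukiRho ω ν` (4.1) and `suzukiAt`/`suzukiBt`/`suzukiEt ω ν t z` (2.12).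

This file is DEFINITIONS + `rfl` unfoldings only (statement lane); every theorem with content —
`m > 0`, `det H = 1`, `H` positive definite, the `t ≤ 0` layer (`μ = 0`, `m = 1`, `H = 1` under (K3)),
`E(t,z) = m·𝖥𝔉 + m⁻¹·𝖥𝔊`, Prop. 3.1/3.3, Cor. 3.1 — is landed separately (cell DBR Theorems files).

## Design choices

* (K2) IN THE TIME DOMAIN. Suzuki states (K2) as `Θ_E(z) = (𝖥K)(z)` for `Im z > c`. Since
  `E♯(z) = E(−z)` under (K1) and `E·𝖥K = 𝖥(ϱ ∗ K)`, (K2) says `𝖥(ϱ ∗ K) = 𝖥(ϱ(−·))` on `Im z > c`,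
  i.e. — by uniqueness of the Fourier–Laplace transform — `∫ ϱ(x−y)K(y) dy = ϱ(−x)` for all `x`.
  `IsSuzukiPair.conv_eq` records (K2) in this time-domain form, which is what §3.6 actually uses
  ((3.9), (3.28), (3.31)); the Fourier–Laplace uniqueness theorem is then not needed downstream.
  (K4) (piecewise `C¹`) and (K5) (no unit eigenvalues) are NOT part of the bundle: (K4) is only used
  for differentiability in `t` and `x` (§3.4), and (K5) enters window by window as the solvability hypothesis
  `∃ X, IsSuzukiPhiSolution K ε t X` of `SuzukiPhiFunctions.lean` (supplied on clean windows by the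
  column's Fredholm-alternative theorems).
* `m(t) = exp ∫₀ᵗ μ` is an interval integral, so `m(t) = exp(−∫_t^0 μ) = 1` for `t ≤ 0` under (K3)
  (`μ = 0` on `(−∞,0)`), matching «we define `m(t) = 1` for `t ≤ 0`» after (3.35). `m(t) > 0` always,
  hence `H(t)` is positive definite of determinant one for EVERY `t` (no junk case; proved downstream).
* `𝔅(t,z) := i·∫𝔊(t,x)e^{izx} dx` transcribes `−i𝔅(t,z) := ∫𝔊(t,x)e^{izx} dx`.
* Junk values: outside solvable windows `suzukiPhiExt = 0`, so `𝔉(t,x) = 𝔊(t,x) = ½ϱ(x−t)` there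
  (documented junk, never used); Bochner integrals of non-integrable functions are `0`.

## Deliberately NOT here (theorems about these objects, landed separately under `Summits/…/Theorems`)

Prop. 3.1 (parity, reality, decay of `𝔉`, `𝔊`), Cor. 3.1 (entireness), Prop. 3.2 (the PDE (3.30)),
Prop. 3.3 ((3.31): `𝔉(0,x) = ½(ϱ(x)+ϱ(−x))`), (3.34)–(3.35) (`m(t) = det(1+𝖪[t])/det(1−𝖪[t])`, which
identifies `hamiltonian (suzukiKernel ω ν)` with `suzukiHamiltonian ω ν` of `SuzukiCanonicalSystem.lean`
on clean windows), Thm. 3.1 (the canonical system), Lemma 4.1 ((K1) for `ϱ_ζ^{ω,ν}`), Thm. 2.2.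

## References
* [Suzuki2021Hamiltonians] M. Suzuki, J. Funct. Anal. 281 (2021) 109116, §3.1 (K1)–(K3), §3.5 (3.23),
  §3.6 (3.26)–(3.27), (3.32)–(3.33), (3.36), (3.38)–(3.40), Thm. 3.1; §4.1 Lemma 4.1 (4.1); Thm. 2.2 (2.12).
-/

noncomputable section

open MeasureTheory Set Complex

namespace Literature.NumberTheory.LFunctions

namespace SuzukiStructure

/-! ### Suzuki's Fourier transform `𝖥` and the transforms `Φ^ε(t,z)` -/

/-- Suzuki's Fourier(–Laplace) transform of a real function, `(𝖥f)(z) = ∫_{−∞}^{∞} f(x) e^{ixz} dx`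
(Bochner integral over `ℝ`; `0` if not integrable). [cite: Suzuki2021Hamiltonians, §3.1 (definition of 𝖥)] -/
def fourier (f : ℝ → ℝ) (z : ℂ) : ℂ :=
  ∫ x : ℝ, (f x : ℂ) * cexp (I * z * x)

/-- Unfolding of `𝖥`. [cite: Suzuki2021Hamiltonians, §3.1 (definition of 𝖥)] -/
theorem fourier_def (f : ℝ → ℝ) (z : ℂ) :
    fourier f z = ∫ x : ℝ, (f x : ℂ) * cexp (I * z * x) := rfl

/-- `Φ^ε(t,z) = ∫_{−∞}^{∞} φ^ε(t,x) e^{izx} dx`, the Fourier transform of the extended solution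
`φ^ε(t,·) = suzukiPhiExt K ε t` (defined for `Im z > c` by Lemma 3.7; Bochner integral, `0` if not
integrable). [cite: Suzuki2021Hamiltonians, §3.6 (definition of Φ^ε after Cor. 3.1)] -/
def phiTransform (K : ℝ → ℝ) (ε t : ℝ) (z : ℂ) : ℂ :=
  fourier (suzukiPhiExt K ε t) z

/-- Unfolding of `Φ^ε`. [cite: Suzuki2021Hamiltonians, §3.6 (definition of Φ^ε after Cor. 3.1)] -/
theorem phiTransform_def (K : ℝ → ℝ) (ε t : ℝ) (z : ℂ) :
    phiTransform K ε t z = ∫ x : ℝ, (suzukiPhiExt K ε t x : ℂ) * cexp (I * z * x) := rfl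

/-! ### `μ(t)`, `m(t)`, `γ(t)` and the Hamiltonian `H(t)` -/

/-- `μ(t) = φ⁺(t,t) + φ⁻(t,t)` (a real-valued function of `t`). [cite: Suzuki2021Hamiltonians, eq. (3.23)] -/
def mu (K : ℝ → ℝ) (t : ℝ) : ℝ :=
  suzukiPhiExt K 1 t t + suzukiPhiExt K (-1) t t

/-- Unfolding of `μ`. [cite: Suzuki2021Hamiltonians, eq. (3.23)] -/
theorem mu_def (K : ℝ → ℝ) (t : ℝ) : mu K t = suzukiPhiExt K 1 t t + suzukiPhiExt K (-1) t t := rfl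

/-- `m(t) = exp(∫₀ᵗ μ(s) ds)` (interval integral; for `t ≤ 0` this is `exp(−∫_t^0 μ)`, which is `1`
under (K3)). [cite: Suzuki2021Hamiltonians, eq. (3.32)] -/
def m (K : ℝ → ℝ) (t : ℝ) : ℝ :=
  Real.exp (∫ s in (0 : ℝ)..t, mu K s)

/-- Unfolding of `m`. [cite: Suzuki2021Hamiltonians, eq. (3.32)] -/
theorem m_def (K : ℝ → ℝ) (t : ℝ) : m K t = Real.exp (∫ s in (0 : ℝ)..t, mu K s) := rfl

/-- `γ(t) = m(t)²`. [cite: Suzuki2021Hamiltonians, eq. (3.33)] -/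
def gamma (K : ℝ → ℝ) (t : ℝ) : ℝ :=
  m K t ^ 2

/-- Unfolding of `γ`. [cite: Suzuki2021Hamiltonians, eq. (3.33)] -/
theorem gamma_def (K : ℝ → ℝ) (t : ℝ) : gamma K t = m K t ^ 2 := rfl

/-- Suzuki's Hamiltonian `H(t) = diag(1/γ(t), γ(t))`, `γ = m²`. [cite: Suzuki2021Hamiltonians, eq. (3.33)] -/
def hamiltonian (K : ℝ → ℝ) (t : ℝ) : Matrix (Fin 2) (Fin 2) ℝ :=
  !![1 / gamma K t, 0; 0, gamma K t]

/-- Unfolding of `H`. [cite: Suzuki2021Hamiltonians, eq. (3.33)] -/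
theorem hamiltonian_def (K : ℝ → ℝ) (t : ℝ) :
    hamiltonian K t = !![1 / gamma K t, 0; 0, gamma K t] := rfl

/-! ### The special functions `𝔉`, `𝔊` (3.26) and `F`, `G` (3.36) -/

/-- The common shape of (3.26): `½(ϱ(x−t) + ε ∫_{(t,∞)} ϱ(x−y) φ^ε(t,y) dy)`; `ε = 1` gives `𝔉(t,x)`,
`ε = −1` gives `𝔊(t,x)`. [cite: Suzuki2021Hamiltonians, eq. (3.26)] -/
def frakFG (ϱ K : ℝ → ℝ) (ε t x : ℝ) : ℝ :=
  1 / 2 * (ϱ (x - t) + ε * ∫ y in Ioi t, ϱ (x - y) * suzukiPhiExt K ε t y)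

/-- `𝔉(t,x) = ½(ϱ(x−t) + ∫_t^∞ ϱ(x−y)φ⁺(t,y) dy)`. [cite: Suzuki2021Hamiltonians, eq. (3.26)] -/
def frakF (ϱ K : ℝ → ℝ) (t x : ℝ) : ℝ :=
  frakFG ϱ K 1 t x

/-- `𝔊(t,x) = ½(ϱ(x−t) − ∫_t^∞ ϱ(x−y)φ⁻(t,y) dy)`. [cite: Suzuki2021Hamiltonians, eq. (3.26)] -/
def frakG (ϱ K : ℝ → ℝ) (t x : ℝ) : ℝ :=
  frakFG ϱ K (-1) t x

/-- Unfolding of the common shape. [cite: Suzuki2021Hamiltonians, eq. (3.26)] -/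
theorem frakFG_def (ϱ K : ℝ → ℝ) (ε t x : ℝ) :
    frakFG ϱ K ε t x = 1 / 2 * (ϱ (x - t) + ε * ∫ y in Ioi t, ϱ (x - y) * suzukiPhiExt K ε t y) := rfl

/-- `𝔉 = frakFG … 1`. [cite: Suzuki2021Hamiltonians, eq. (3.26)] -/
theorem frakF_def (ϱ K : ℝ → ℝ) (t : ℝ) : frakF ϱ K t = frakFG ϱ K 1 t := rfl

/-- `𝔊 = frakFG … (−1)`. [cite: Suzuki2021Hamiltonians, eq. (3.26)] -/
theorem frakG_def (ϱ K : ℝ → ℝ) (t : ℝ) : frakG ϱ K t = frakFG ϱ K (-1) t := rfl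

/-- `F(t,x) = m(t)·𝔉(t,x)`. [cite: Suzuki2021Hamiltonians, eq. (3.36)] -/
def bigF (ϱ K : ℝ → ℝ) (t x : ℝ) : ℝ :=
  m K t * frakF ϱ K t x

/-- `G(t,x) = m(t)⁻¹·𝔊(t,x)`. [cite: Suzuki2021Hamiltonians, eq. (3.36)] -/
def bigG (ϱ K : ℝ → ℝ) (t x : ℝ) : ℝ :=
  (m K t)⁻¹ * frakG ϱ K t x

/-- Unfolding of `F`. [cite: Suzuki2021Hamiltonians, eq. (3.36)] -/
theorem bigF_def (ϱ K : ℝ → ℝ) (t x : ℝ) : bigF ϱ K t x = m K t * frakF ϱ K t x := rfl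

/-- Unfolding of `G`. [cite: Suzuki2021Hamiltonians, eq. (3.36)] -/
theorem bigG_def (ϱ K : ℝ → ℝ) (t x : ℝ) : bigG ϱ K t x = (m K t)⁻¹ * frakG ϱ K t x := rfl

/-! ### `𝔄`, `𝔅` (3.27), `A(t,z)`, `B(t,z)` (3.38) and `E(t,z)` (3.39) -/

/-- `𝔄(t,z) = ∫ 𝔉(t,x) e^{izx} dx`. [cite: Suzuki2021Hamiltonians, eq. (3.27)] -/
def frakA (ϱ K : ℝ → ℝ) (t : ℝ) (z : ℂ) : ℂ :=
  fourier (frakF ϱ K t) z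

/-- `𝔅(t,z) = i·∫ 𝔊(t,x) e^{izx} dx` (printed as `−i𝔅(t,z) := ∫ 𝔊(t,x)e^{izx} dx`).
[cite: Suzuki2021Hamiltonians, eq. (3.27)] -/
def frakB (ϱ K : ℝ → ℝ) (t : ℝ) (z : ℂ) : ℂ :=
  I * fourier (frakG ϱ K t) z

/-- Unfolding of `𝔄`. [cite: Suzuki2021Hamiltonians, eq. (3.27)] -/
theorem frakA_def (ϱ K : ℝ → ℝ) (t : ℝ) (z : ℂ) : frakA ϱ K t z = fourier (frakF ϱ K t) z := rfl

/-- Unfolding of `𝔅`. [cite: Suzuki2021Hamiltonians, eq. (3.27)] -/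
theorem frakB_def (ϱ K : ℝ → ℝ) (t : ℝ) (z : ℂ) : frakB ϱ K t z = I * fourier (frakG ϱ K t) z := rfl

/-- `A(t,z) = m(t)·𝔄(t,z)`. [cite: Suzuki2021Hamiltonians, eq. (3.38)] -/
def structA (ϱ K : ℝ → ℝ) (t : ℝ) (z : ℂ) : ℂ :=
  (m K t : ℂ) * frakA ϱ K t z

/-- `B(t,z) = m(t)⁻¹·𝔅(t,z)`. [cite: Suzuki2021Hamiltonians, eq. (3.38)] -/
def structB (ϱ K : ℝ → ℝ) (t : ℝ) (z : ℂ) : ℂ :=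
  ((m K t)⁻¹ : ℝ) * frakB ϱ K t z

/-- `E(t,z) = A(t,z) − iB(t,z)`. [cite: Suzuki2021Hamiltonians, eq. (3.39)] -/
def structE (ϱ K : ℝ → ℝ) (t : ℝ) (z : ℂ) : ℂ :=
  structA ϱ K t z - I * structB ϱ K t z

/-- Unfolding of `A(t,z)`. [cite: Suzuki2021Hamiltonians, eq. (3.38)] -/
theorem structA_def (ϱ K : ℝ → ℝ) (t : ℝ) (z : ℂ) :
    structA ϱ K t z = (m K t : ℂ) * frakA ϱ K t z := rfl

/-- Unfolding of `B(t,z)`. [cite: Suzuki2021Hamiltonians, eq. (3.38)] -/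
theorem structB_def (ϱ K : ℝ → ℝ) (t : ℝ) (z : ℂ) :
    structB ϱ K t z = ((m K t)⁻¹ : ℝ) * frakB ϱ K t z := rfl

/-- Unfolding of `E(t,z)`. [cite: Suzuki2021Hamiltonians, eq. (3.39)] -/
theorem structE_def (ϱ K : ℝ → ℝ) (t : ℝ) (z : ℂ) :
    structE ϱ K t z = structA ϱ K t z - I * structB ϱ K t z := rfl

/-! ### Suzuki's standing data (K1)–(K3), in the form consumed downstream -/

/-- **Suzuki's data (K1)–(K3) for the pair `(ϱ, K)`** — `ϱ` the function of (K1) (real, continuous,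
`|ϱ(x)| ≪_n e^{−n|x|}` for every `n`, `E = 𝖥ϱ`) and `K` the kernel of (K2)–(K3) (real, continuous,
`|K(x)| ≪ e^{c|x|}`, vanishing on `(−∞,0]`), with (K2) `Θ_E = E♯/E = 𝖥K` recorded IN THE TIME DOMAIN as
`ϱ ∗ K = ϱ(−·)` (module docstring, «Design choices»: `E·𝖥K = E♯ = E(−·)` ⟺ `𝖥(ϱ∗K) = 𝖥(ϱ(−·))`).
(K4) and (K5) are not part of this bundle. [cite: Suzuki2021Hamiltonians, §3.1 (K1)–(K3)] -/
structure IsSuzukiPair (ϱ K : ℝ → ℝ) : Prop where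
  /-- (K1): `ϱ` is continuous. -/
  continuous_rho : Continuous ϱ
  /-- (K1): `|ϱ(x)| ≪_n e^{−n|x|}` for every `n`. -/
  abs_rho_le : ∀ n : ℝ, ∃ C : ℝ, ∀ x : ℝ, |ϱ x| ≤ C * Real.exp (-(n * |x|))
  /-- (K2): `K` is continuous. -/
  continuous_kernel : Continuous K
  /-- (K2): `|K(x)| ≪ e^{c|x|}` for some `c ≥ 0`. -/
  abs_kernel_le : ∃ c C : ℝ, 0 ≤ c ∧ ∀ x : ℝ, |K x| ≤ C * Real.exp (c * |x|)
  /-- (K3): `K` vanishes on `(−∞,0]` (at `0` by continuity). -/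
  kernel_eq_zero : ∀ x : ℝ, x ≤ 0 → K x = 0
  /-- (K2) in the time domain: `∫ ϱ(x−y)K(y) dy = ϱ(−x)` for every `x` (`E·Θ_E = E♯`). -/
  conv_eq : ∀ x : ℝ, ∫ y : ℝ, ϱ (x - y) * K y = ϱ (-x)

end SuzukiStructure

/-! ### The `ζ` specialisation: `ϱ_ζ^{ω,ν}` (4.1) and `A^{ω,ν}(t,z)`, `B^{ω,ν}(t,z)`, `E^{ω,ν}(t,z)` (2.12) -/

/-- `ϱ_ζ^{ω,ν}(x) = (1/2π) ∫_{Im z = 0} E_ζ^{ω,ν}(z) e^{−izx} dz` (Lemma 4.1, (4.1) with `c = 0`, where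
the integral is real; we take the real part). [cite: Suzuki2021Hamiltonians, Lemma 4.1, eq. (4.1)] -/
def suzukiRho (ω : ℝ) (ν : ℕ) (x : ℝ) : ℝ :=
  (invFourierLine (suzukiE ω ν) 0 x).re

/-- Unfolding of `ϱ_ζ^{ω,ν}`. [cite: Suzuki2021Hamiltonians, Lemma 4.1, eq. (4.1)] -/
theorem suzukiRho_def (ω : ℝ) (ν : ℕ) (x : ℝ) :
    suzukiRho ω ν x = (invFourierLine (suzukiE ω ν) 0 x).re := rfl

/-- `A_ζ^{ω,ν}(t,z)`: Suzuki's `A(t,z)` (3.38) for the data `(ϱ_ζ^{ω,ν}, K_ζ^{ω,ν})`.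
[cite: Suzuki2021Hamiltonians, Thm. 2.2, eq. (2.12)] -/
def suzukiAt (ω : ℝ) (ν : ℕ) (t : ℝ) (z : ℂ) : ℂ :=
  SuzukiStructure.structA (suzukiRho ω ν) (suzukiKernel ω ν) t z

/-- `B_ζ^{ω,ν}(t,z)`: Suzuki's `B(t,z)` (3.38) for the data `(ϱ_ζ^{ω,ν}, K_ζ^{ω,ν})`.
[cite: Suzuki2021Hamiltonians, Thm. 2.2, eq. (2.12)] -/
def suzukiBt (ω : ℝ) (ν : ℕ) (t : ℝ) (z : ℂ) : ℂ :=
  SuzukiStructure.structB (suzukiRho ω ν) (suzukiKernel ω ν) t z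

/-- `E_ζ^{ω,ν}(t,z) = A_ζ^{ω,ν}(t,z) − iB_ζ^{ω,ν}(t,z)`. [cite: Suzuki2021Hamiltonians, Thm. 2.2, eq. (2.12)] -/
def suzukiEt (ω : ℝ) (ν : ℕ) (t : ℝ) (z : ℂ) : ℂ :=
  SuzukiStructure.structE (suzukiRho ω ν) (suzukiKernel ω ν) t z

/-- Unfolding: `E_ζ^{ω,ν}(t,z) = A_ζ^{ω,ν}(t,z) − iB_ζ^{ω,ν}(t,z)`. [cite: Suzuki2021Hamiltonians, eq. (2.12)] -/
theorem suzukiEt_eq (ω : ℝ) (ν : ℕ) (t : ℝ) (z : ℂ) :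
    suzukiEt ω ν t z = suzukiAt ω ν t z - I * suzukiBt ω ν t z := rfl

end Literature.NumberTheory.LFunctions

/-! ## Appendix (rh-dbr-eng-5 g7, 2026-08-27): the dynamics of Thm. 3.1 (2), (4), TYPED AS PRINTED

What the DBR column has PROVED about the objects above (files `Summits/RiemannHypothesis/RiemannHypothesis/
Theorems/SuzukiStructureFunctions{Basic,Convolution,Parity,Entire,HalfPlane,XiStrip,ZetaPair,ZetaInversion}.lean`):
Thm. 3.1 (1), (3), (5), Prop. 3.1, Prop. 3.3, Cor. 3.1, Lemma 3.7, eqs. (3.9), (3.27)₂, (3.40), and for `ζ`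
Lemma 4.1 with `IsSuzukiPair (suzukiRho ω ν) (suzukiKernel ω ν)` (`ω > 0`, `ν ≥ 1`, `νω > 1`).
What is NOT proved in the tree and is typed below as a NAMED FACT (the column's declared residual for this corpus;
RH-FREE, an analysis debt — Lemmas 3.5–3.6 via Fredholm minors, the first-order system (3.24)–(3.25), Prop. 3.2,
(3.37)): Thm. 3.1 (2) «`A(t,z)`, `B(t,z)` are continuous and piecewise continuously differentiable functions of `t`»
and (4) «`ᵗ(A(t,z),B(t,z))` solves the canonical system (2.11) on `[0,τ)` associated with `H`», where for
`H = diag(1/γ, γ)` the system `−d/dt ᵗ(A,B) = z [[0,−1],[1,0]] H ᵗ(A,B)` reads `∂_t A = zγB`, `∂_t B = −zγ⁻¹A`. -/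

namespace Literature.NumberTheory.LFunctions

namespace SuzukiStructure

/-- (K4): `K` is continuously differentiable outside a discrete (here: locally finite) subset `Λ ⊂ ℝ` and
`|K′|` is locally integrable on `ℝ` (`deriv K` carries Lean's junk value `0` on `Λ`, immaterial for local
integrability). [cite: Suzuki2021Hamiltonians, §3.1 (K4)] -/
def IsPiecewiseC1 (K : ℝ → ℝ) : Prop :=
  ∃ Λ : Set ℝ, (∀ a b : ℝ, (Λ ∩ Set.Icc a b).Finite) ∧ (∀ x : ℝ, x ∉ Λ → DifferentiableAt ℝ K x) ∧
    ContinuousOn (deriv K) Λᶜ ∧ MeasureTheory.LocallyIntegrable (deriv K)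

/-- The canonical system (2.11) with the diagonal Hamiltonian `H(t) = diag(1/γ(t), γ(t))`, on a set `S` of
times, for a pair `(A(t,z), B(t,z))`: since `[[0,−1],[1,0]]·diag(1/γ,γ) = [[0,−γ],[1/γ,0]]`,
`−d/dt ᵗ(A,B) = z [[0,−1],[1,0]] H ᵗ(A,B)` is `∂_t A(t,z) = zγ(t)B(t,z)` and `∂_t B(t,z) = −zγ(t)⁻¹A(t,z)`
(stated entrywise with `HasDerivAt` in `t`, at every `t ∈ S`, for every complex `z`).
[cite: Suzuki2021Hamiltonians, eq. (2.11) with (3.33)] -/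
def SolvesCanonicalSystemOn (γ : ℝ → ℝ) (A B : ℝ → ℂ → ℂ) (S : Set ℝ) : Prop :=
  ∀ z : ℂ, ∀ t : ℝ, t ∈ S →
    HasDerivAt (fun s : ℝ => A s z) (z * (γ t : ℂ) * B t z) t ∧
      HasDerivAt (fun s : ℝ => B s z) (-(z * ((γ t)⁻¹ : ℝ) * A t z)) t

/-- **Suzuki 2021, Thm. 3.1 (2) and (4)** — RH-FREE NAMED FACT (not proved in the tree; the DBR column's declared
residual for the structure-function corpus). For Suzuki data (K1)–(K5) on `[0,τ)` — here: `IsSuzukiPair ϱ K`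
((K1)–(K3) with (K2) in the time domain), `ϱ ∈ C¹` (the printed (K1)), `IsPiecewiseC1 K` ((K4)) and
`NoUnitEigenvalue K t` for all `0 ≤ t < τ` ((K5)) — the structure functions `A(t,z) = structA ϱ K t z`,
`B(t,z) = structB ϱ K t z` are continuous in `t ∈ [0,τ)` for every `z`, `m(t)` is continuous on `[0,τ)`, and off
a locally finite set of times `ᵗ(A(t,z),B(t,z))` solves the canonical system for `H = diag(1/γ,γ)`, `γ = m²`
(3.33), at every `t ∈ (0,τ)`: `∂_t A = zγB`, `∂_t B = −zγ⁻¹A` (printed: «continuous and piecewise continuously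
differentiable function of `t`», «solves the canonical system (2.11) on `[0,τ)` associated with `H`»; the
pointwise equations are asserted here only off the exceptional set, which is weaker than or equal to the print).
[cite: Suzuki2021Hamiltonians, Thm. 3.1 (2), (4)] -/
def Suzuki2021_thm31_dynamics : Prop :=
  ∀ (ϱ K : ℝ → ℝ) (τ : ℝ), 0 < τ → IsSuzukiPair ϱ K → ContDiff ℝ 1 ϱ → IsPiecewiseC1 K →
    (∀ t : ℝ, t ∈ Set.Ico 0 τ → NoUnitEigenvalue K t) →
    (∀ z : ℂ, ContinuousOn (fun t : ℝ => structA ϱ K t z) (Set.Ico 0 τ) ∧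
        ContinuousOn (fun t : ℝ => structB ϱ K t z) (Set.Ico 0 τ)) ∧
      ContinuousOn (m K) (Set.Ico 0 τ) ∧
      ∃ D : Set ℝ, (∀ a b : ℝ, (D ∩ Set.Icc a b).Finite) ∧
        SolvesCanonicalSystemOn (gamma K) (structA ϱ K) (structB ϱ K) (Set.Ioo 0 τ \ D)

end SuzukiStructure

end Literature.NumberTheory.LFunctions
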